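import Summits.AtomisticToContinuum.FouriersLaw.Theses.OddSectorIrreversibility
import Literature.MathematicalPhysics.KineticTheory.OddSectorLocalityHypothesis
import Literature.MathematicalPhysics.KineticTheory.LangevinChainSDE
import Mathlib.Probability.Distributions.Gaussian.Multivariate

/-!
# Sketch — crux idea `tangent-mass-memory` (crux `stmt-AtomisticToContinuum-9139`, `OddCorrectorDecay`)

crux-ideate round 1, ideator 2 (gen 2), 2026-08-16.  Elaboration check of the First lemma and of
the line's statements. PROVED here (0 sorry, standard axioms): the three glue theorems (how the idea
plugs into the LANDED negative lemma `oddCorrectorDecay_false_of_dictionary_of_memory` and into the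
Literature fact `OddSectorLocalityHypothesis` on which the item is HELD) and the rate/quantifier
reduction `memoryReduction_holds : MemoryReduction`
(`DeficitTangentBound → GibbsExtremeValue → GibbsGradMoment → CurrentNormLinearLower → TangentMassMemory`),
so the only open statements of the line are the four analytic inputs and the First lemma's chain
`TangentColumnSum → TangentMassGronwall → DeficitTangentBound`.

The idea discharges clause (5) MEMORY of `OddSectorLocalityHypothesis` — "∀ S > 0 ∃ N, 0 < M_N ≤ 2A_N(S)"
— WITHOUT any light-cone / propagation estimate:

* deficit identity + Gaussian ROTATION coupling: `M_N - A_N(s) = ½ E|J(X_s) - J(X'_s)|²` (two noise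
  replicas from one Gibbs point) `≤ (π²/8) E[(DJ(X_s)·Y_s)²]`, `Y` = linear response of the
  stationary chain to an INDEPENDENT copy of the boundary noise (every interpolant `X^φ`,
  `B^φ = sin φ B + cos φ B'`, is a stationary copy of the chain);
* TANGENT MASS: `|DJ(X_s)·Y_s| ≤ A_max(X_s)·‖Y_s‖_{ℓ¹}` and the linearised drift has ℓ¹→ℓ¹ norm
  `≤ 1 + 2γ + K_max(q)`, `K_max` = max over sites of the local curvature (column sums of the
  tridiagonal Hessian) — `TangentColumnSum` (FIRST LEMMA) and `TangentMassGronwall`;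
* EXTREME VALUES under Gibbs: `E_μ e^{a K_max} = N^{o(1)}` (quartic tails of `q_i`, `r_i`),
  `E_μ A_max⁴ = N^{o(1)}`; stationarity turns every path functional into a static Gibbs integral;
* hence `M_N - A_N(s) ≤ C(s)·N^{o(1)}·Z_N` while `M_N ≥ c·N·Z_N`: `A_N(s)/M_N → 1`.
-/

noncomputable section

open MeasureTheory Set Filter Topology intervalIntegral
open Literature.MathematicalPhysics.KineticTheory.HeatConduction
open Literature.MathematicalPhysics.KineticTheory.OddSectorLocality
open Summit.AtomisticToContinuum.FouriersLaw.Theses.OddSectorIrreversibility (OddCorrectorDecay)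

namespace Summit.AtomisticToContinuum.FouriersLaw.Cruxes.OddCorrectorDecay.TangentMass

/-! ### The two quantities of the lever -/

/-- ℓ¹ mass of a tangent vector `v = (δq, δp)`: `∑_i (|δq_i| + |δp_i|)`. -/
def l1Norm {N : ℕ} (v : PhaseSpace N) : ℝ := ∑ i, (|v.1 i| + |v.2 i|)

/-- A bound for the maximal LOCAL curvature of the pinned chain at the configuration `q`:
`|ω₂| + 4 + 3·lam·max_j q_j² + 12·β·max_bonds r²` dominates every column sum
`|U''(q_j)| + 2V''(r_{j-1}) + 2V''(r_j)` of the tridiagonal Hessian of `Φ`. -/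
def siteCurvBound (ω₂ lam β : ℝ) {N : ℕ} (q : Fin N → ℝ) : ℝ :=
  |ω₂| + 4 + 3 * lam * (⨆ j : Fin N, (q j) ^ 2) +
    12 * β * (⨆ j : Fin N, ⨆ k : Fin N, if k.val = j.val + 1 then (q k - q j) ^ 2 else 0)

/-- ℓ^∞ size of the gradient of an observable (the dual quantity to the ℓ¹ tangent mass). -/
def gradSup {N : ℕ} (f : PhaseSpace N → ℝ) (x : PhaseSpace N) : ℝ :=
  ⨆ k : Fin N, max |partialQ k f x| |partialP k f x|

/-- The total current `J_tot = ∑_i j_i` of the pinned chain. -/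
def Jtot (ω₂ lam β γ : ℝ) (N : ℕ) (x : PhaseSpace N) : ℝ :=
  ∑ i : Fin N, (pinnedChain ω₂ lam β γ).bondCurrent N i x

/-! ### FIRST LEMMA — the ℓ¹ column-sum bound of the linearised drift -/

/-- **First lemma (`TangentColumnSum`).** For the pinned chain the derivative of the Langevin drift
`DY(x)v = (v.2, -Hess Φ(q) v.1 - γ 1_B v.2)` (`fderiv_drift_apply`) is bounded on ℓ¹ by the
MAXIMAL LOCAL curvature, not by the total energy:
`‖DY(x)v‖_{ℓ¹} ≤ (1 + 2|γ| + K(q)) ‖v‖_{ℓ¹}`, `K = siteCurvBound` — because the Hessian of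
`Φ(q) = ∑U(q_i) + ∑V(q_{i+1}-q_i)` is tridiagonal with column sums `|U''(q_j)| + 2V''(r_{j-1}) + 2V''(r_j)`
(`hessPotential_eq_zero_of_le`, `pinnedChain_deriv_deriv_V`). Size M. -/
def TangentColumnSum : Prop :=
  ∀ ω₂ lam β γ : ℝ, 0 ≤ lam → 0 ≤ β → ∀ (N : ℕ) (x v : PhaseSpace N),
    l1Norm (fderiv ℝ ((pinnedChain ω₂ lam β γ).drift N) x v) ≤
      (1 + 2 * |γ| + siteCurvBound ω₂ lam β x.1) * l1Norm v

/-- **Tangent-mass Grönwall.** Along ANY continuous path `z` (in the application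
`z = chainFlow x η`, the pathwise Langevin flow), every continuous solution of the linearised
integral equation `w(τ) = w(0) + ∫₀^τ DY(z(s)) w(s) ds` (the tree's `pinnedChainVariation_eq` with
zero forcing after the kick) keeps its ℓ¹ mass below `‖w(0)‖_{ℓ¹} exp ∫₀ᵗ (1 + 2|γ| + K(q(s))) ds`.
(Grönwall for the ℓ¹ functional; from `TangentColumnSum`.) Size M. -/
def TangentMassGronwall : Prop :=
  ∀ ω₂ lam β γ : ℝ, 0 ≤ lam → 0 ≤ β → ∀ (N : ℕ) (z w : ℝ → PhaseSpace N) (t : ℝ), 0 ≤ t →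
    Continuous z → Continuous w →
    (∀ τ ∈ Icc (0:ℝ) t, w τ = w 0 +
      ∫ s in (0:ℝ)..τ, fderiv ℝ ((pinnedChain ω₂ lam β γ).drift N) (z s) (w s)) →
    l1Norm (w t) ≤ l1Norm (w 0) *
      Real.exp (∫ s in (0:ℝ)..t, (1 + 2 * |γ| + siteCurvBound ω₂ lam β (z s).1))

/-! ### The probabilistic core of the rotation coupling (finite-dimensional form) -/

/-- **Gaussian rotation Poincaré inequality** (Pisier's rotation proof, constant `π²/8`):
for the standard Gaussian `γ_n` on `ℝⁿ` and `f ∈ C¹` with `f², ‖Df‖² ∈ L¹(γ_n)`,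
`Var_{γ_n} f ≤ (π²/8) ∫ ‖Df‖² dγ_n` — proof: `f(X) - f(X') = ∫₀^{π/2} Df(X_φ)·X̃_φ dφ` with
`(X_φ, X̃_φ) = (sin φ X + cos φ X', cos φ X - sin φ X')` again a standard Gaussian PAIR
(`ProbabilityTheory.stdGaussian_map` for the rotation of `ℝⁿ × ℝⁿ`), then Cauchy–Schwarz in `φ`.
Applied conditionally on the Gibbs point to the dyadic skeleton of the boundary Brownian pair
(`LangevinChainSkeletonFlow`, `LangevinChainVariational`) it gives the deficit identity
`M_N - A_N(s) ≤ (π²/8) E[(DJ(X_s)·Y_s)²]`. Size M (Mathlib has `stdGaussian_map`). -/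
def GaussianRotationPoincare : Prop :=
  ∀ (n : ℕ) (f : EuclideanSpace ℝ (Fin n) → ℝ), ContDiff ℝ 1 f →
    Integrable (fun x => f x ^ 2) (ProbabilityTheory.stdGaussian (EuclideanSpace ℝ (Fin n))) →
    Integrable (fun x => ‖fderiv ℝ f x‖ ^ 2) (ProbabilityTheory.stdGaussian (EuclideanSpace ℝ (Fin n))) →
    (∫ x, f x ^ 2 ∂(ProbabilityTheory.stdGaussian (EuclideanSpace ℝ (Fin n)))) -
        (∫ x, f x ∂(ProbabilityTheory.stdGaussian (EuclideanSpace ℝ (Fin n)))) ^ 2 ≤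
      Real.pi ^ 2 / 8 *
        ∫ x, ‖fderiv ℝ f x‖ ^ 2 ∂(ProbabilityTheory.stdGaussian (EuclideanSpace ℝ (Fin n)))

/-! ### The model-specific deficit bound (the lever applied to the crux's objects) -/

/-- **Deficit ≤ tangent mass.** For the equilibrium pinned chain (all parameters `> 0`), every `N`
and every `s ≥ 0`, with `w = gibbsWeight` (unnormalised, as in the crux), `J = Jtot`,
`K = siteCurvBound`, `A = gradSup J`:
`M_N - A_N(s) ≤ (π²/2)·γT·s·e^{2(1+2γ)s} · (∫ A⁴ dw)^{1/2} · (∫ e^{4sK} dw)^{1/2}`.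
Chain: rotation coupling (`GaussianRotationPoincare` on the skeleton, limit by
`LangevinChainNoiseContinuity`) ⇒ `M - A(s) ≤ (π²/8)·Z·E[(DJ(X_s)·Y_s)²]`; Wiener isometry for the
linear response `Y_s = ∫₀^s U(s,r)σ dB̃_r` (or pathwise integration by parts) ⇒
`E[(DJ(X_s)·Y_s)² | X] = 2γT ∑_b ∫₀^s (DJ(X_s)·U(s,r)e_{p_b})² dr`; `TangentMassGronwall` ⇒
`≤ 2γT·2·s·A(X_s)² e^{2∫₀^s(1+2γ+K(X_u))du}`; Cauchy–Schwarz, Jensen in `u` and STATIONARITY of the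
equilibrium process (invariance of `μ_T`, dictionary (1)) turn the path expectation into the two
static Gibbs integrals. Size L (the hardest statement of the line). -/
def DeficitTangentBound : Prop :=
  ∀ ω₂ lam β γ T : ℝ, 0 < ω₂ → 0 < lam → 0 < β → 0 < γ → 0 < T → ∀ (N : ℕ) (s : ℝ), 0 ≤ s →
    currentNormSq ω₂ lam β γ T N - forecastNormSq ω₂ lam β γ T N s ≤
      Real.pi ^ 2 / 2 * γ * T * s * Real.exp (2 * (1 + 2 * γ) * s) *
        Real.sqrt (∫ x, (gradSup (Jtot ω₂ lam β γ N) x) ^ 4 ∂(gibbsWeight ω₂ lam β γ T N)) *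
        Real.sqrt (∫ x, Real.exp (4 * s * siteCurvBound ω₂ lam β x.1) ∂(gibbsWeight ω₂ lam β γ T N))

/-! ### Equilibrium (static) inputs: extreme values and the extensive floor -/

/-- **Extreme values under Gibbs.** Quartic pinning and quartic coupling give uniform-in-`(N,i)`
single-site tails `P(|q_i| > x), P(|r_i| > x) ≤ Ce^{-cx⁴}` (site/bond removal decouples the
log-concave configurational measure; Prékopa + Brascamp–Lieb), hence for every `a, ε > 0`:
`∫ e^{aK} dw ≤ C_{a,ε} (N+1)^ε · Z_N` — the max over `N` sites costs `e^{O(a√log N + a²)} = N^{o(1)}`,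
not a power of `N`. Size M–L. -/
def GibbsExtremeValue : Prop :=
  ∀ ω₂ lam β γ T : ℝ, 0 < ω₂ → 0 < lam → 0 < β → 0 < T → ∀ a : ℝ, 0 < a → ∀ ε : ℝ, 0 < ε →
    ∃ C : ℝ, ∀ N : ℕ,
      ∫ x, Real.exp (a * siteCurvBound ω₂ lam β x.1) ∂(gibbsWeight ω₂ lam β γ T N) ≤
        C * ((N : ℝ) + 1) ^ ε * ((gibbsWeight ω₂ lam β γ T N) Set.univ).toReal

/-- Polynomial moments of the ℓ^∞-gradient of the total current under Gibbs are `N^{o(1)}`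
(`∂J/∂p_k = -½(V'(r_{k-1}) + V'(r_k))`, `∂J/∂q_k = ½(p_k+p_{k+1})V''(r_k) - ½(p_{k-1}+p_k)V''(r_{k-1})`:
maxima of `N` variables with stretched-exponential tails). Size M. -/
def GibbsGradMoment : Prop :=
  ∀ ω₂ lam β γ T : ℝ, 0 < ω₂ → 0 < lam → 0 < β → 0 < T → ∀ ε : ℝ, 0 < ε → ∃ C : ℝ, ∀ N : ℕ,
    ∫ x, (gradSup (Jtot ω₂ lam β γ N) x) ^ 4 ∂(gibbsWeight ω₂ lam β γ T N) ≤
      C * ((N : ℝ) + 1) ^ ε * ((gibbsWeight ω₂ lam β γ T N) Set.univ).toReal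

/-- **The extensive floor** `M_N ≥ c·N·Z_N` (`N ≥ 2`): given `q` the momenta are i.i.d. `N(0,T)`,
so `M_N/Z_N = (T/4) ∑_k E(V'(r_{k-1}) + V'(r_k))² ≥ (T/4) ∑_k E Var(V'(r_k) | q_j, j ≠ k+1) ≥ cN`
(conditional variance of a non-constant function under a one-site log-concave law whose
parameters are `O(1)` with probability `≥ ½`). The converse of the route's `CurrentVarianceLinear`.
Size M. -/
def CurrentNormLinearLower : Prop :=
  ∀ ω₂ lam β γ T : ℝ, 0 < ω₂ → 0 < lam → 0 < β → 0 < γ → 0 < T → ∃ c : ℝ, 0 < c ∧ ∀ N : ℕ, 2 ≤ N →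
    0 < currentNormSq ω₂ lam β γ T N ∧
      c * (N : ℝ) * ((gibbsWeight ω₂ lam β γ T N) Set.univ).toReal ≤ currentNormSq ω₂ lam β γ T N

/-! ### MEMORY, in the strong all-parameter form, and the plumbing into the landed negative lemma -/

/-- **Tangent-mass memory** (clause (5) of `OddSectorLocalityHypothesis` at EVERY admissible
parameter point and with retention `1 - ε` instead of `½`): for fixed `S` the `L²(μ_T)`-memory of
the total current is asymptotically complete, `A_N(S) ≥ (1-ε) M_N` for `N ≥ N₀(S, ε)`. -/
def TangentMassMemory : Prop :=
  ∀ ω₂ lam β γ T : ℝ, 0 < ω₂ → 0 < lam → 0 < β → 0 < γ → 0 < T → ∀ S : ℝ, 0 ≤ S → ∀ ε : ℝ, 0 < ε →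
    ∃ N₀ : ℕ, ∀ N : ℕ, N₀ ≤ N →
      (1 - ε) * currentNormSq ω₂ lam β γ T N ≤ forecastNormSq ω₂ lam β γ T N S

/-- The reduction of the line (stated): deficit bound + the two static extreme-value inputs + the
extensive floor give tangent-mass memory (`C(s)(N+1)^{ε}Z_N ≤ ε'·c·N·Z_N` for `N` large, `ε < 1`). -/
def MemoryReduction : Prop :=
  DeficitTangentBound → GibbsExtremeValue → GibbsGradMoment → CurrentNormLinearLower → TangentMassMemory

/-- PROVED glue 1: tangent-mass memory and the extensive floor give the memory clause of
`OddSectorLocalityHypothesis` / `hMem` of `oddCorrectorDecay_false_of_dictionary_of_memory`,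
at every admissible parameter point. -/
theorem memory_of_tangentMassMemory (hM : TangentMassMemory) (hL : CurrentNormLinearLower)
    {ω₂ lam β γ T : ℝ} (hω : 0 < ω₂) (hl : 0 < lam) (hβ : 0 < β) (hγ : 0 < γ) (hT : 0 < T) :
    ∀ S : ℝ, 0 < S → ∃ N : ℕ, 0 < currentNormSq ω₂ lam β γ T N ∧
      currentNormSq ω₂ lam β γ T N ≤ 2 * forecastNormSq ω₂ lam β γ T N S := by
  intro S hS
  obtain ⟨N₀, hN₀⟩ := hM ω₂ lam β γ T hω hl hβ hγ hT S hS.le (1 / 2) (by norm_num)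
  obtain ⟨c, hc, hcN⟩ := hL ω₂ lam β γ T hω hl hβ hγ hT
  refine ⟨max N₀ 2, (hcN _ (le_max_right _ _)).1, ?_⟩
  have h := hN₀ (max N₀ 2) (le_max_left _ _)
  linarith

/-- PROVED glue 2: with the dictionary (1)–(4) at ONE admissible point (the disprover's `hD`) the
tangent-mass line closes the crux NEGATIVELY through the LANDED lemma
`Summit.AtomisticToContinuum.FouriersLaw.Theorems.OddSectorLocality.oddCorrectorDecay_false_of_oddSectorLocalityHypothesis`
(p73979, `Theorems/OddCorrectorDecay/Negative/FalseOfLocality.lean`; passed here as the hypothesis `hNeg`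
only because the farm snapshot used for this check predates its build — the statement is verbatim). -/
theorem not_oddCorrectorDecay_of_tangentMass
    (hNeg : Literature.MathematicalPhysics.KineticTheory.OddSectorLocalityHypothesis → ¬ OddCorrectorDecay)
    (hM : TangentMassMemory) (hL : CurrentNormLinearLower)
    (hD : ∀ N : ℕ,
      AntitoneOn (forecastNormSq 1 1 1 1 1 N) (Ici 0) ∧
      (∀ u : ℝ, 0 ≤ u → currentAutocorr 1 1 1 1 1 N u ≤ currentNormSq 1 1 1 1 1 N) ∧
      (∀ t : ℝ, 0 ≤ t → oddPartNormSq 1 1 1 1 1 N t =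
        2 * forecastNormSq 1 1 1 1 1 N t + 2 * currentAutocorr 1 1 1 1 1 N (2 * t)) ∧
      (∀ S : ℝ, 0 < S → 0 ≤ ∫ u in (0:ℝ)..S, (S - u) * currentAutocorr 1 1 1 1 1 N u)) :
    ¬ OddCorrectorDecay :=
  hNeg ⟨1, 1, 1, 1, 1, one_pos, one_pos, one_pos, one_pos, one_pos, hD,
    memory_of_tangentMassMemory hM hL one_pos one_pos one_pos one_pos one_pos⟩

/-- PROVED glue 3: the same, packaged as the Literature named fact (choosing any admissible point,
here `(1,1,1,1,1)`), so that the HELD item's `needs` is met verbatim. -/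
theorem oddSectorLocalityHypothesis_of_tangentMass (hM : TangentMassMemory) (hL : CurrentNormLinearLower)
    (hD : ∀ N : ℕ,
      AntitoneOn (forecastNormSq 1 1 1 1 1 N) (Ici 0) ∧
      (∀ u : ℝ, 0 ≤ u → currentAutocorr 1 1 1 1 1 N u ≤ currentNormSq 1 1 1 1 1 N) ∧
      (∀ t : ℝ, 0 ≤ t → oddPartNormSq 1 1 1 1 1 N t =
        2 * forecastNormSq 1 1 1 1 1 N t + 2 * currentAutocorr 1 1 1 1 1 N (2 * t)) ∧
      (∀ S : ℝ, 0 < S → 0 ≤ ∫ u in (0:ℝ)..S, (S - u) * currentAutocorr 1 1 1 1 1 N u)) :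
    Literature.MathematicalPhysics.KineticTheory.OddSectorLocalityHypothesis :=
  ⟨1, 1, 1, 1, 1, one_pos, one_pos, one_pos, one_pos, one_pos, hD,
    memory_of_tangentMassMemory hM hL one_pos one_pos one_pos one_pos one_pos⟩


/-! ### PROVED: the reduction `MemoryReduction` (quantifier/rate plumbing of the line is kernel-tight) -/

/-- Elementary: `√(N+1) ≤ √2 · √N` for `1 ≤ N`. -/
theorem sqrt_succ_le (N : ℕ) (hN : 1 ≤ N) :
    Real.sqrt ((N : ℝ) + 1) ≤ Real.sqrt 2 * Real.sqrt (N : ℝ) := by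
  have hN' : (1 : ℝ) ≤ N := by exact_mod_cast hN
  rw [← Real.sqrt_mul (by norm_num : (0:ℝ) ≤ 2)]
  exact Real.sqrt_le_sqrt (by linarith)

/-- **`MemoryReduction` holds**: the deficit bound, the two static extreme-value inputs (at exponent
`½`) and the extensive floor give tangent-mass memory at every admissible point, every horizon
`S ≥ 0` and every `ε > 0` — `C(S)·√(N+1)·Z_N ≤ ε·c·N·Z_N ≤ ε·M_N` for `N ≥ N₀(S,ε)`. -/
theorem memoryReduction_holds : MemoryReduction := by
  intro hDef hEV hGM hLow ω₂ lam β γ T hω hl hβ hγ hT S hS ε hε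
  have hM0 : ∀ N, 0 ≤ currentNormSq ω₂ lam β γ T N :=
    fun N => integral_nonneg fun x => sq_nonneg _
  obtain ⟨c, hc, hcN⟩ := hLow ω₂ lam β γ T hω hl hβ hγ hT
  rcases eq_or_lt_of_le hS with hS0 | hSpos
  · -- horizon `S = 0`: the deficit bound has the factor `s = 0`
    subst hS0
    refine ⟨0, fun N _ => ?_⟩
    have h := hDef ω₂ lam β γ T hω hl hβ hγ hT N 0 le_rfl
    simp only [mul_zero, zero_mul] at h
    have hM := hM0 N
    nlinarith [hM, hε.le, h]
  · -- horizon `S > 0`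
    obtain ⟨C₁, hC₁⟩ := hGM ω₂ lam β γ T hω hl hβ hT (1 / 2) (by norm_num)
    obtain ⟨C₂, hC₂⟩ := hEV ω₂ lam β γ T hω hl hβ hT (4 * S) (by positivity) (1 / 2) (by norm_num)
    set C₁' : ℝ := max C₁ 0 with hC₁'
    set C₂' : ℝ := max C₂ 0 with hC₂'
    have hC₁'0 : 0 ≤ C₁' := le_max_right _ _
    have hC₂'0 : 0 ≤ C₂' := le_max_right _ _
    set Kf : ℝ := Real.pi ^ 2 / 2 * γ * T * S * Real.exp (2 * (1 + 2 * γ) * S) with hKf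
    have hKf0 : 0 ≤ Kf := by positivity
    set L : ℝ := Kf * (Real.sqrt C₁' * Real.sqrt C₂') with hL
    have hL0 : 0 ≤ L := by positivity
    have hεc : 0 < ε * c := mul_pos hε hc
    -- the threshold
    refine ⟨max 2 (⌈2 * L ^ 2 / (ε * c) ^ 2⌉₊ + 1), fun N hN => ?_⟩
    have hN2 : 2 ≤ N := le_trans (le_max_left _ _) hN
    have hNceil : ⌈2 * L ^ 2 / (ε * c) ^ 2⌉₊ + 1 ≤ N := le_trans (le_max_right _ _) hN
    have hNR : (2 : ℝ) ≤ N := by exact_mod_cast hN2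
    have hN1 : 1 ≤ N := le_trans (by norm_num) hN2
    -- collect the four inputs at this `N`
    have hdef := hDef ω₂ lam β γ T hω hl hβ hγ hT N S hS
    have h1 := hC₁ N
    have h2 := hC₂ N
    obtain ⟨hMpos, hlow⟩ := hcN N hN2
    set M : ℝ := currentNormSq ω₂ lam β γ T N with hMdef
    set A : ℝ := forecastNormSq ω₂ lam β γ T N S with hAdef
    set Z : ℝ := ((gibbsWeight ω₂ lam β γ T N) Set.univ).toReal with hZdef
    set I₁ : ℝ := ∫ x, (gradSup (Jtot ω₂ lam β γ N) x) ^ 4 ∂(gibbsWeight ω₂ lam β γ T N) with hI₁def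
    set I₂ : ℝ := ∫ x, Real.exp (4 * S * siteCurvBound ω₂ lam β x.1) ∂(gibbsWeight ω₂ lam β γ T N)
      with hI₂def
    have hZ0 : 0 ≤ Z := ENNReal.toReal_nonneg
    have hI₁0 : 0 ≤ I₁ := integral_nonneg fun x => by positivity
    have hI₂0 : 0 ≤ I₂ := integral_nonneg fun x => (Real.exp_pos _).le
    -- `u = √(N+1) · Z`
    have hrpow : ((N : ℝ) + 1) ^ (1 / 2 : ℝ) = Real.sqrt ((N : ℝ) + 1) := by
      rw [Real.sqrt_eq_rpow]
    rw [hrpow] at h1 h2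
    set u : ℝ := Real.sqrt ((N : ℝ) + 1) * Z with hudef
    have hu0 : 0 ≤ u := mul_nonneg (Real.sqrt_nonneg _) hZ0
    have h1' : I₁ ≤ C₁' * u := by
      calc I₁ ≤ C₁ * Real.sqrt ((N : ℝ) + 1) * Z := h1
        _ = C₁ * u := by rw [hudef]; ring
        _ ≤ C₁' * u := mul_le_mul_of_nonneg_right (le_max_left _ _) hu0
    have h2' : I₂ ≤ C₂' * u := by
      calc I₂ ≤ C₂ * Real.sqrt ((N : ℝ) + 1) * Z := h2
        _ = C₂ * u := by rw [hudef]; ring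
        _ ≤ C₂' * u := mul_le_mul_of_nonneg_right (le_max_left _ _) hu0
    -- `√I₁ √I₂ ≤ √C₁' √C₂' u`
    have hsq : Real.sqrt I₁ * Real.sqrt I₂ ≤ Real.sqrt C₁' * Real.sqrt C₂' * u := by
      have e1 : Real.sqrt I₁ ≤ Real.sqrt C₁' * Real.sqrt u := by
        rw [← Real.sqrt_mul hC₁'0]; exact Real.sqrt_le_sqrt h1'
      have e2 : Real.sqrt I₂ ≤ Real.sqrt C₂' * Real.sqrt u := by
        rw [← Real.sqrt_mul hC₂'0]; exact Real.sqrt_le_sqrt h2'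
      calc Real.sqrt I₁ * Real.sqrt I₂
          ≤ (Real.sqrt C₁' * Real.sqrt u) * (Real.sqrt C₂' * Real.sqrt u) :=
            mul_le_mul e1 e2 (Real.sqrt_nonneg _) (by positivity)
        _ = Real.sqrt C₁' * Real.sqrt C₂' * (Real.sqrt u * Real.sqrt u) := by ring
        _ = Real.sqrt C₁' * Real.sqrt C₂' * u := by rw [Real.mul_self_sqrt hu0]
    -- the deficit at this `N`
    have hdef' : M - A ≤ L * u := by
      calc M - A ≤ Kf * Real.sqrt I₁ * Real.sqrt I₂ := hdef
        _ = Kf * (Real.sqrt I₁ * Real.sqrt I₂) := by ring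
        _ ≤ Kf * (Real.sqrt C₁' * Real.sqrt C₂' * u) := mul_le_mul_of_nonneg_left hsq hKf0
        _ = L * u := by rw [hL]; ring
    -- `L u ≤ ε c N Z`
    have hceil : 2 * L ^ 2 / (ε * c) ^ 2 ≤ (N : ℝ) := by
      have a1 : 2 * L ^ 2 / (ε * c) ^ 2 ≤ (⌈2 * L ^ 2 / (ε * c) ^ 2⌉₊ : ℝ) := Nat.le_ceil _
      have a2 : ((⌈2 * L ^ 2 / (ε * c) ^ 2⌉₊ : ℕ) : ℝ) ≤ N := by exact_mod_cast (le_trans (Nat.le_succ _) hNceil)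
      linarith
    have hsqN : L * Real.sqrt 2 ≤ ε * c * Real.sqrt (N : ℝ) := by
      have b1 : 2 * L ^ 2 ≤ (ε * c) ^ 2 * (N : ℝ) := by
        rw [div_le_iff₀ (by positivity)] at hceil
        linarith
      have b2 : Real.sqrt (2 * L ^ 2) ≤ Real.sqrt ((ε * c) ^ 2 * (N : ℝ)) := Real.sqrt_le_sqrt b1
      have b3 : Real.sqrt (2 * L ^ 2) = L * Real.sqrt 2 := by
        rw [Real.sqrt_mul (by norm_num : (0:ℝ) ≤ 2), Real.sqrt_sq hL0]; ring
      have b4 : Real.sqrt ((ε * c) ^ 2 * (N : ℝ)) = ε * c * Real.sqrt (N : ℝ) := by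
        rw [Real.sqrt_mul (by positivity), Real.sqrt_sq hεc.le]
      rwa [b3, b4] at b2
    have hLu : L * u ≤ ε * c * (N : ℝ) * Z := by
      have d1 : u ≤ Real.sqrt 2 * Real.sqrt (N : ℝ) * Z :=
        mul_le_mul_of_nonneg_right (sqrt_succ_le N hN1) hZ0
      calc L * u ≤ L * (Real.sqrt 2 * Real.sqrt (N : ℝ) * Z) := mul_le_mul_of_nonneg_left d1 hL0
        _ = (L * Real.sqrt 2) * Real.sqrt (N : ℝ) * Z := by ring
        _ ≤ (ε * c * Real.sqrt (N : ℝ)) * Real.sqrt (N : ℝ) * Z := by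
            gcongr
        _ = ε * c * (Real.sqrt (N : ℝ) * Real.sqrt (N : ℝ)) * Z := by ring
        _ = ε * c * (N : ℝ) * Z := by rw [Real.mul_self_sqrt (by positivity)]
    -- conclude with the floor `c N Z ≤ M`
    have hfin : M - A ≤ ε * M := by
      calc M - A ≤ L * u := hdef'
        _ ≤ ε * c * (N : ℝ) * Z := hLu
        _ = ε * (c * (N : ℝ) * Z) := by ring
        _ ≤ ε * M := mul_le_mul_of_nonneg_left hlow hε.le
    linarith

end Summit.AtomisticToContinuum.FouriersLaw.Cruxes.OddCorrectorDecay.TangentMass
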